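import Mathlib
import Summits.QuantumFields.QCD.Theorems.WilsonQuarkChessboardBackgroundSchwarzFields

/-!
# The block reindexing of the torus (helper for `BackgroundSchwarz`)

For an even side `L = 2K + 4` the index set `site × colour × spin` of the Wilson–Dirac matrix is
reindexed by `(ι ⊕ ι) ⊕ (β ⊕ β)` (Lüscher's `ξ/η` split, Montvay–Münster (4.102), at the two
reflection hyperplanes `x₀ = 0, L/2`):

* `ι = Fin 2 × Fin (K+1) × R` (`R` = spatial site × colour × spin component): the POSITIVE interior,
  sign block `σ`, time `k + 1 ∈ [1, L/2 - 1]`; the second copy is its REFLECTION (time `-(k+1)`);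
* `β = Fin 2 × R` twice: the hyperplane components that are positive as columns / negative as rows
  (`(+, x₀ = 0)` and `(-, x₀ = L/2)`), and those positive as rows / negative as columns
  (`(-, 0)`, `(+, L/2)`).

This file records the `ZMod L` arithmetic of these times and proves that the reindexing map `Emb`
is a bijection.
-/

noncomputable section

namespace Summit.QuantumFields.QCD.Theorems.BackgroundSchwarz

open Matrix Complex Finset
open Literature.MathematicalPhysics Literature.MathematicalPhysics.QuantumLattice
  Literature.MathematicalPhysics.QuantumFieldTheory Literature.Probability.LatticeModels

variable {L N : ℕ} [NeZero L] {K : ℕ}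

/-- Interior positive time `k + 1`. -/
local notation "τP[" k "]" => ((((k : ℕ) + 1 : ℕ) : ZMod L))
/-- Hyperplane times `0` and `K + 2 = L/2`. -/
local notation "τB[" c "]" => ((![(0 : ZMod L), ((K + 2 : ℕ) : ZMod L)] : Fin 2 → ZMod L) c)
/-- The swapped sign block. -/
local notation "σ2[" c "]" => ((![(1 : Fin 2), 0] : Fin 2 → Fin 2) c)

/-! ## Times -/

section Times

variable (hK : L = 2 * K + 4)
include hK

omit [NeZero L] in
/-- The representative of an interior positive time. -/
theorem val_τP (k : Fin (K + 1)) : (τP[k]).val = (k : ℕ) + 1 := by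
  rw [ZMod.val_cast_of_lt (by omega)]

/-- The representative of a reflected interior time. -/
theorem val_neg_τP (k : Fin (K + 1)) : (-τP[k]).val = L - 1 - k := by
  rw [val_neg_eq, val_τP hK, if_neg (by omega)]
  omega

omit [NeZero L] in
/-- The representatives of the hyperplane times. -/
theorem val_τB (c : Fin 2) : (τB[c]).val = if c = 0 then 0 else K + 2 := by
  fin_cases c
  · simp
  · simp only [Fin.mk_one, Fin.isValue, Matrix.cons_val_one, Matrix.cons_val_fin_one, one_ne_zero, if_false]
    rw [ZMod.val_cast_of_lt (by omega)]

/-- The hyperplane times are fixed by the reflection. -/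
theorem neg_τB (c : Fin 2) : -τB[c] = τB[c] := by
  rw [zmod_eq_iff_val, val_neg_eq, val_τB hK]
  fin_cases c
  · simp
  · simp; omega

omit [NeZero L] in
/-- `1 < L`. -/
theorem fact_one_lt : Fact (1 < L) := ⟨by omega⟩

omit [NeZero L] in
/-- `L` is even. -/
theorem two_mul_half : 2 * (L / 2) = L := by omega

omit [NeZero L] in
/-- `L / 2 = K + 2`. -/
theorem half_eq : L / 2 = K + 2 := by omega

/-- `a = b + 1` in `ZMod L` through representatives. -/
theorem eq_add_one_iff_val (a b : ZMod L) : a = b + 1 ↔ a.val = if b.val + 1 = L then 0 else b.val + 1 := by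
  haveI := fact_one_lt hK
  rw [zmod_eq_iff_val, val_add_one]

/-! ### The facts consumed by the block identification -/

/-- Interior positive times are not reflected interior times. -/
theorem τP_ne_neg_τP (k k' : Fin (K + 1)) : τP[k] ≠ -τP[k'] := by
  have := k.2
  rw [Ne, zmod_eq_iff_val, val_τP hK, val_neg_τP hK]; omega

/-- Interior positive times are not hyperplane times. -/
theorem τP_ne_τB (k : Fin (K + 1)) (c : Fin 2) : τP[k] ≠ τB[c] := by
  have := k.2
  rw [Ne, zmod_eq_iff_val, val_τP hK, val_τB hK]
  split_ifs
  · exact not_false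
  · omega

/-- Reflected interior times are not hyperplane times. -/
theorem neg_τP_ne_τB (k : Fin (K + 1)) (c : Fin 2) : -τP[k] ≠ τB[c] := by
  have := k.2
  rw [Ne, zmod_eq_iff_val, val_neg_τP hK, val_τB hK]; split_ifs <;> omega

/-- Interior positive times are distinct. -/
theorem τP_inj {k k' : Fin (K + 1)} (h : τP[k] = τP[k']) : k = k' := by
  rw [zmod_eq_iff_val, val_τP hK, val_τP hK] at h; exact Fin.ext (by omega)

/-- Reflected interior times are distinct. -/
theorem neg_τP_inj {k k' : Fin (K + 1)} (h : -τP[k] = -τP[k']) : k = k' := τP_inj hK (neg_inj.1 h)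

omit [NeZero L] in
/-- The two hyperplane times are distinct. -/
theorem τB_inj {c c' : Fin 2} (h : τB[c] = τB[c']) : c = c' := by
  have hv := congrArg ZMod.val h
  rw [val_τB hK, val_τB hK] at hv
  fin_cases c <;> fin_cases c' <;> simp at hv ⊢

/-- No time-like hop joins the positive interior to the reflected interior. -/
theorem neg_τP_ne_τP_add_one (k k' : Fin (K + 1)) : -τP[k'] ≠ τP[k] + 1 := by
  have := k.2; have := k'.2
  rw [Ne, eq_add_one_iff_val hK, val_τP hK, val_neg_τP hK]; split_ifs <;> omega

/-- No time-like hop joins the reflected interior to the positive interior. -/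
theorem τP_ne_neg_τP_add_one (k k' : Fin (K + 1)) : τP[k] ≠ -τP[k'] + 1 := by
  have := k.2; have := k'.2
  rw [Ne, eq_add_one_iff_val hK, val_τP hK, val_neg_τP hK]
  split_ifs
  · exact not_false
  · omega

/-- `τB c = τP k + 1` only for `c = 1` (and `k = K`). -/
theorem τB_eq_τP_add_one {k : Fin (K + 1)} {c : Fin 2} (h : τB[c] = τP[k] + 1) : c = 1 := by
  have := k.2
  rw [eq_add_one_iff_val hK, val_τP hK, val_τB hK] at h
  fin_cases c
  · exfalso; simp at h; omega
  · rfl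

/-- `τP k = τB c + 1` only for `c = 0` (and `k = 0`). -/
theorem τP_eq_τB_add_one {k : Fin (K + 1)} {c : Fin 2} (h : τP[k] = τB[c] + 1) : c = 0 := by
  have := k.2
  rw [eq_add_one_iff_val hK, val_τP hK, val_τB hK] at h
  fin_cases c
  · rfl
  · exfalso; simp at h; split_ifs at h; omega

/-- `τB c = -τP k + 1` only for `c = 0` and `k = 0`. -/
theorem τB_eq_neg_τP_add_one {k : Fin (K + 1)} {c : Fin 2} (h : τB[c] = -τP[k] + 1) : c = 0 ∧ (k : ℕ) = 0 := by
  have := k.2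
  rw [eq_add_one_iff_val hK, val_neg_τP hK, val_τB hK] at h
  fin_cases c
  · simp at h; exact ⟨rfl, by omega⟩
  · exfalso; simp at h; split_ifs at h; omega

/-- `-τP k = τB c + 1` only for `c = 1` and `k = K`. -/
theorem neg_τP_eq_τB_add_one {k : Fin (K + 1)} {c : Fin 2} (h : -τP[k] = τB[c] + 1) : c = 1 ∧ (k : ℕ) = K := by
  have := k.2
  rw [eq_add_one_iff_val hK, val_neg_τP hK, val_τB hK] at h
  fin_cases c
  · exfalso; simp at h; split_ifs at h <;> omega
  · simp at h; exact ⟨rfl, by split_ifs at h <;> omega⟩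

/-- The hyperplanes are not adjacent. -/
theorem τB_ne_τB_add_one (c c' : Fin 2) : τB[c'] ≠ τB[c] + 1 := by
  rw [Ne, eq_add_one_iff_val hK, val_τB hK, val_τB hK]
  fin_cases c <;> fin_cases c'
  · simp; omega
  · simp
    split_ifs
    · exact not_false
    · omega
  · simp; omega
  · simp
    split_ifs
    · exact not_false
    · omega

/-- `-τP k' = -τP k + 1` forces `k ≠ 0` (the seam is never crossed inside the reflected interior). -/
theorem val_neg_τP_add_one_ne {k k' : Fin (K + 1)} (h : -τP[k'] = -τP[k] + 1) : (-τP[k]).val + 1 ≠ L := by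
  have := k'.2; have := k.2
  rw [eq_add_one_iff_val hK, val_neg_τP hK, val_neg_τP hK] at h
  rw [val_neg_τP hK]
  split_ifs at h <;> omega

/-- Reflected interior times lie in the negative half. -/
theorem neg_τP_half (k : Fin (K + 1)) : -τP[k] = 0 ∨ L / 2 ≤ (-τP[k]).val := by
  right; rw [val_neg_τP hK]; have := k.2; omega

/-- Reflected interior times have representative at least `L/2`. -/
theorem half_le_val_neg_τP (k : Fin (K + 1)) : L / 2 ≤ (-τP[k]).val := by
  rw [val_neg_τP hK]; have := k.2; omega

omit [NeZero L] in
/-- Hyperplane times lie in (the closure of) both halves. -/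
theorem τB_half (c : Fin 2) : τB[c] = 0 ∨ L / 2 ≤ (τB[c]).val := by
  fin_cases c
  · left; simp
  · right; rw [val_τB hK]; simp; omega

omit [NeZero L] in
/-- Hyperplane times have representative at most `L/2`. -/
theorem val_τB_le (c : Fin 2) : (τB[c]).val ≤ L / 2 := by
  rw [val_τB hK]; split_ifs <;> omega

omit [NeZero L] in
/-- Interior positive times have representative at most `L/2`. -/
theorem val_τP_le (k : Fin (K + 1)) : (τP[k]).val ≤ L / 2 := by
  rw [val_τP hK]; have := k.2; omega

omit [NeZero L] in
/-- The seam condition on the hyperplanes: never. -/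
theorem val_τB_add_one_ne (c : Fin 2) : (τB[c]).val + 1 ≠ L := by
  rw [val_τB hK]; split_ifs <;> omega

/-- The seam condition in the reflected interior: exactly `k = 0`. -/
theorem val_neg_τP_add_one_eq_iff (k : Fin (K + 1)) : (-τP[k]).val + 1 = L ↔ (k : ℕ) = 0 := by
  rw [val_neg_τP hK]; have := k.2; omega

end Times


/-! ## The reindexing map -/

set_option quotPrecheck false in
/-- The reindexing map `(ι ⊕ ι) ⊕ (β ⊕ β) → site × colour × spin` (positive interior, reflected
interior, the two hyperplane halves). -/
local notation "Emb" => ((Sum.elim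
    (Sum.elim
      (fun i : Fin 2 × Fin (K + 1) × ((Fin 3 → ZMod L) × Fin N × Fin 2) =>
        (((Fin.cons τP[i.2.1] i.2.2.1 : TorusSite 4 L)), i.2.2.2.1, spin4[i.1, i.2.2.2.2]))
      (fun i : Fin 2 × Fin (K + 1) × ((Fin 3 → ZMod L) × Fin N × Fin 2) =>
        (((Fin.cons (-τP[i.2.1]) i.2.2.1 : TorusSite 4 L)), i.2.2.2.1, spin4[i.1, i.2.2.2.2])))
    (Sum.elim
      (fun i : Fin 2 × ((Fin 3 → ZMod L) × Fin N × Fin 2) =>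
        (((Fin.cons τB[i.1] i.2.1 : TorusSite 4 L)), i.2.2.1, spin4[i.1, i.2.2.2]))
      (fun i : Fin 2 × ((Fin 3 → ZMod L) × Fin N × Fin 2) =>
        (((Fin.cons τB[i.1] i.2.1 : TorusSite 4 L)), i.2.2.1, spin4[σ2[i.1], i.2.2.2])))) :
    (Fin 2 × Fin (K + 1) × ((Fin 3 → ZMod L) × Fin N × Fin 2) ⊕
        Fin 2 × Fin (K + 1) × ((Fin 3 → ZMod L) × Fin N × Fin 2)) ⊕
      (Fin 2 × ((Fin 3 → ZMod L) × Fin N × Fin 2) ⊕ Fin 2 × ((Fin 3 → ZMod L) × Fin N × Fin 2)) →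
      TorusSite 4 L × Fin N × Fin 4)

section Reindex

variable (hK : L = 2 * K + 4)
include hK

omit [NeZero L] hK in
/-- `σ2` has no fixed point. -/
theorem σ2_ne (c : Fin 2) : σ2[c] ≠ c := by fin_cases c <;> simp

omit [NeZero L] hK in
/-- `σ2` is injective. -/
theorem σ2_inj {c c' : Fin 2} (h : σ2[c] = σ2[c']) : c = c' := by
  fin_cases c <;> fin_cases c' <;> simp_all

/-- **The reindexing map is injective.** -/
theorem emb_injective : Function.Injective (Emb : _ → TorusSite 4 L × Fin N × Fin 4) := by
  intro I J h
  rcases I with ((i | i) | (i | i)) <;> rcases J with ((j | j) | (j | j)) <;>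
    simp only [Sum.elim_inl, Sum.elim_inr, Prod.mk.injEq, Fin.cons_inj] at h <;>
    obtain ⟨⟨h1, h2⟩, h3, h4⟩ := h
  -- positive interior
  · obtain ⟨h5, h6⟩ := spin4_inj h4
    have h7 := τP_inj hK h1
    rw [Prod.ext h5 (Prod.ext h7 (Prod.ext h2 (Prod.ext h3 h6)))]
  · exact absurd h1 (τP_ne_neg_τP hK _ _)
  · exact absurd h1 (τP_ne_τB hK _ _)
  · exact absurd h1 (τP_ne_τB hK _ _)
  -- reflected interior
  · exact absurd h1.symm (τP_ne_neg_τP hK _ _)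
  · obtain ⟨h5, h6⟩ := spin4_inj h4
    have h7 := neg_τP_inj hK h1
    rw [Prod.ext h5 (Prod.ext h7 (Prod.ext h2 (Prod.ext h3 h6)))]
  · exact absurd h1 (neg_τP_ne_τB hK _ _)
  · exact absurd h1 (neg_τP_ne_τB hK _ _)
  -- hyperplane halves, first kind
  · exact absurd h1.symm (τP_ne_τB hK _ _)
  · exact absurd h1.symm (neg_τP_ne_τB hK _ _)
  · obtain ⟨h5, h6⟩ := spin4_inj h4
    rw [Prod.ext h5 (Prod.ext h2 (Prod.ext h3 h6))]
  · obtain ⟨h5, -⟩ := spin4_inj h4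
    have h7 := τB_inj hK h1
    exact absurd (h7 ▸ h5).symm (σ2_ne _)
  -- hyperplane halves, second kind
  · exact absurd h1.symm (τP_ne_τB hK _ _)
  · exact absurd h1.symm (neg_τP_ne_τB hK _ _)
  · obtain ⟨h5, -⟩ := spin4_inj h4
    have h7 := τB_inj hK h1
    exact absurd (h7 ▸ h5) (σ2_ne _)
  · obtain ⟨h5, h6⟩ := spin4_inj h4
    rw [Prod.ext (σ2_inj h5) (Prod.ext h2 (Prod.ext h3 h6))]

/-- **Counting**: `2·ι + 2·β` has the cardinality of `site × colour × spin` (`4 L⁴ N`). -/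
theorem card_domain_eq :
    Fintype.card ((Fin 2 × Fin (K + 1) × ((Fin 3 → ZMod L) × Fin N × Fin 2) ⊕
        Fin 2 × Fin (K + 1) × ((Fin 3 → ZMod L) × Fin N × Fin 2)) ⊕
      (Fin 2 × ((Fin 3 → ZMod L) × Fin N × Fin 2) ⊕ Fin 2 × ((Fin 3 → ZMod L) × Fin N × Fin 2))) =
      Fintype.card (TorusSite 4 L × Fin N × Fin 4) := by
  simp only [Fintype.card_sum, Fintype.card_prod, Fintype.card_fin, Fintype.card_pi, Finset.prod_const,
    Finset.card_univ, ZMod.card]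
  subst hK
  ring

/-- **The reindexing map is a bijection.** -/
theorem emb_bijective : Function.Bijective (Emb : _ → TorusSite 4 L × Fin N × Fin 4) :=
  (Fintype.bijective_iff_injective_and_card _).2 ⟨emb_injective hK, card_domain_eq hK⟩

end Reindex

end Summit.QuantumFields.QCD.Theorems.BackgroundSchwarz
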